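import Summits.RiemannHypothesis.RiemannHypothesis.Theorems.WeilColumnThetaAtomMollified
import Summits.RiemannHypothesis.RiemannHypothesis.Theorems.WeilColumnThetaMajorantE1
import HarnessLib

/-!
# THETA certificate, tier 2 — E8: the one atom `n = q` with a CELLWISE bottom-layer constant (RH-FREE)

Cell `rh-explicit`, WEIL column, seat cc-s2-3 gen23 (TIER2-SOUNDNESS-PLAN v1.1 §2 E8 / §6; cc-s2-1 gen22 TIER2-KERNEL-SPEC §2
«Layer remainder (`rTerm`)», §5 (K5)). Tier 1 (`WeilColumnThetaAtomBound`, `WeilColumnThetaAtomMollified`) bounds the theta series on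
the bottom layer `u ∈ [e^{−a}, e^{−a+2δ}]` by `M_L = M·e^{m(2δ−η)}` (D1) and hard-wires `P.atom` into the spine
`weilSemilocalThreshold_lt_of_full_le`. The tier-2 kernel uses instead `M_L = M₀·sLayer·e^{m(2δ−η)}` with `sLayer ≥ sup` of the
sine-kept bracket `S(t)` on the depth layer `t ∈ [η − 2δ, η]` (E1). This file:

* §1/§2 tier 1's `rbar`/`atom` written out with the layer constant `L` as a variable (no new definitions), and the D4 chain for ANY layer constant `L ≥ 0` with `‖Θ(e^v)‖ ≤ L` on `v ∈ [−a, 2δ − a]`: `norm_g_bottom_le_of_layer`,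
  `atom_norm_sub_le_of_layer`, `atom_re_le_of_layer`, `eventually_atom_phi_le_of_layer`,
  `eventually_re_weilSemilocalQuadratic_phi_le_of_layer` and the SPINE **`weilSemilocalThreshold_lt_of_full_le_of_layer`**
  (`∀ e>0, ∀ᶠ k, Re Q(φ_k) ≤ B + e` and `B − 2 log q·I + atom(L) < 0` ⇒ `a*(S_q) < (log q⁺)/2`, `atom(L) = (2 log q/√q)·(4δe^δh_max·L·χ_L + 2δ(e^δ/√q)L²χ_L²)`);
* §3 **E8 proper, `norm_Θ_exp_le_ML₂`**: from weil-1's E1 `norm_Θ_exp_le_sine` and a layer supremum `sLayer` of the bracket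
  (the kernel's (K1L)), `‖Θ(e^v)‖ ≤ M₀·sLayer·e^{m(2δ−η)}` on the bottom layer — the `L` of §2 in the tier-2 assembly (E10).

Proofs of §2 are tier 1's with `P.ML ↦ L`. Upper-clause bookkeeping only; nothing here bears on the truth of RH.
-/

noncomputable section

set_option linter.dupNamespace false

open Complex Set MeasureTheory Filter Finset
open scoped Real Topology ComplexConjugate

namespace Summit.RiemannHypothesis.RiemannHypothesis.Theorems.WeilColumn.ThetaMellin

open Literature.NumberTheory.LFunctions Literature.NumberTheory.LFunctions.WeilContinuous ThetaParams

namespace ThetaParams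

variable {P : ThetaParams}

/-! ## §1 Notation-free convention
Throughout, for a layer constant `L` the tier-1 lets `rbar`/`atom` (`WeilColumnThetaWitness`) are written out with `P.ML ↦ L`:
`r̄(L) = 4δe^δ·h_max·L·χ_L + 2δ(e^δ/√q)·L²·χ_L²`, `atom(L) = (2 log q/√q)·r̄(L)` (no new definitions, so that tier 1 is
literally the case `L = P.ML`). -/

/-! ## §2 The D4 chain for an arbitrary layer constant -/

/-- `1 ≤ m` for an admissible row. -/
private theorem one_le_m_layer {qn : ℕ} (hP : P.Admissible qn) : 1 ≤ P.m := le_trans (by norm_num) hP.three_le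

/-- `0 ≤ χ_L`. -/
private theorem chiL_nonneg_layer {qn : ℕ} (hP : P.Admissible qn) : 0 ≤ P.chiL :=
  (P.cut_mem_Icc hP.eta_pos (one_le_m_layer hP) _).1

/-- **The bottom layer of `g` under a layer majorant**: if `‖Θ(e^v)‖ ≤ L` for `v ∈ [−a, 2δ − a]` then
`‖g(v)‖ ≤ e^{v/2}·L·χ_L` there (`χ` monotone, `χ_L = χ(2δ − a)`). [THETA-CERT-cc6 §D4] -/
theorem norm_g_bottom_le_of_layer {qn : ℕ} (hP : P.Admissible qn) {L : ℝ} (hL : 0 ≤ L)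
    (hΘL : ∀ v : ℝ, -P.a ≤ v → v ≤ 2 * P.δ - P.a → ‖P.Θ (Real.exp v)‖ ≤ L)
    {v : ℝ} (hv₁ : -P.a ≤ v) (hv : v ≤ 2 * P.δ - P.a) :
    ‖P.g v‖ ≤ Real.exp (v / 2) * L * P.chiL := by
  have hm := one_le_m_layer hP
  have hχ := P.cut_mem_Icc hP.eta_pos hm v
  have hχL : P.cut v ≤ P.chiL := P.cut_mono hP.eta_pos hm hv
  rw [g, norm_mul, Complex.norm_real, Real.norm_of_nonneg hχ.1]
  have hG₀ : ‖P.G₀ v‖ ≤ Real.exp (v / 2) * L := by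
    show ‖expProfile P.Θ v‖ ≤ _
    rw [expProfile, norm_mul, Complex.norm_real, Real.norm_of_nonneg (Real.exp_pos _).le]
    exact mul_le_mul_of_nonneg_left (hΘL v hv₁ hv) (Real.exp_pos _).le
  exact mul_le_mul hG₀ hχL hχ.1 (by positivity)

/-- **The one-atom decomposition under a layer majorant**: with `S_bot = e^{(2δ−a)/2}·L·χ_L`,
`‖k(log q) + k(−log q) + 2√q·I‖ ≤ 8δ·e^{a/2}·S_bot + 4δ·S_bot²`. [THETA-CERT-cc6 §D4] -/
theorem atom_norm_sub_le_of_layer {qn : ℕ} (hP : P.Admissible qn) (hq : 2 ≤ P.q) {L : ℝ} (hL : 0 ≤ L)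
    (hΘL : ∀ v : ℝ, -P.a ≤ v → v ≤ 2 * P.δ - P.a → ‖P.Θ (Real.exp v)‖ ≤ L) :
    ‖weilConv P.gOdd (weilReflect P.gOdd) (Real.log P.q) + weilConv P.gOdd (weilReflect P.gOdd) (-Real.log P.q) +
        2 * ((Real.sqrt P.q * P.Itop : ℝ) : ℂ)‖ ≤
      8 * P.δ * Real.exp (P.a / 2) * (Real.exp ((2 * P.δ - P.a) / 2) * L * P.chiL) +
        4 * P.δ * (Real.exp ((2 * P.δ - P.a) / 2) * L * P.chiL) ^ 2 := by
  have hδ := hP.delta_pos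
  have hq0 : (0 : ℝ) < P.q := by exact_mod_cast (lt_of_lt_of_le (by norm_num) hq)
  have hχ := chiL_nonneg_layer hP
  have htop : ∀ w ∈ Icc (0 : ℝ) (2 * P.δ),
      P.g (P.a - w) = ((Real.exp ((P.a - w) / 2) * (fun w ↦ P.Rtop (P.τ₁ w)) w : ℝ) : ℂ) := by
    intro w hw
    rw [g_top hP hq (by linarith [hw.2])]
    simp only [sub_sub_cancel]
  have hStop : ∀ x ∈ Icc (P.a - 2 * P.δ) P.a, ‖P.g x‖ ≤ Real.exp (P.a / 2) := fun x hx ↦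
    (norm_g_top_le hP hx.1).trans (Real.exp_le_exp.2 (by linarith [hx.2]))
  have hSbot : ∀ x ∈ Icc (-P.a) (-P.a + 2 * P.δ), ‖P.g x‖ ≤ Real.exp ((2 * P.δ - P.a) / 2) * L * P.chiL := by
    intro x hx
    refine (norm_g_bottom_le_of_layer hP hL hΘL hx.1 (by linarith [hx.2])).trans ?_
    have : Real.exp (x / 2) ≤ Real.exp ((2 * P.δ - P.a) / 2) := Real.exp_le_exp.2 (by linarith [hx.2])
    gcongr
  have h := ThetaAtom.norm_atom_sub_le (g := P.g) (a := P.a) hδ (continuous_g hP) P.conj_g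
    (fun x hx ↦ g_eq_zero_of_le hP hx.le) (fun x hx ↦ g_eq_zero_of_lt hP hx) htop (Real.exp_pos _).le
    (by positivity) hStop hSbot
  have hgOdd : (fun u ↦ P.g u - P.g (-u)) = P.gOdd := rfl
  rw [hgOdd, ← log_q_eq P, Real.exp_half, Real.exp_log hq0] at h
  exact h

/-- **THE ONE-ATOM INEQUALITY (D4) under a layer majorant**:
`(log q/√q)·Re(k(log q) + k(−log q)) ≤ −2 log q·I + atom(L)`. [THETA-CERT-cc6 §D4; TIER2-KERNEL-SPEC §5 (K5)] -/
theorem atom_re_le_of_layer {qn : ℕ} (hP : P.Admissible qn) (hq : 2 ≤ P.q) {L : ℝ} (hL : 0 ≤ L)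
    (hΘL : ∀ v : ℝ, -P.a ≤ v → v ≤ 2 * P.δ - P.a → ‖P.Θ (Real.exp v)‖ ≤ L) :
    Real.log P.q / Real.sqrt P.q *
        (weilConv P.gOdd (weilReflect P.gOdd) (Real.log P.q) + weilConv P.gOdd (weilReflect P.gOdd) (-Real.log P.q)).re ≤
      -2 * Real.log P.q * P.Itop +
        2 * Real.log P.q / Real.sqrt P.q *
        (4 * P.δ * Real.exp P.δ * P.hmax * L * P.chiL + 2 * P.δ * (Real.exp P.δ / Real.sqrt P.q) * L ^ 2 * P.chiL ^ 2) := by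
  have hq1 : 1 ≤ P.q := le_trans (by norm_num) hq
  have hq1' : (1 : ℝ) ≤ P.q := by exact_mod_cast hq1
  have hq0 : (0 : ℝ) < P.q := by linarith
  have hlog : 0 ≤ Real.log P.q := Real.log_nonneg hq1'
  have hsq : 0 < Real.sqrt P.q := Real.sqrt_pos.2 hq0
  have hw : 0 ≤ Real.log P.q / Real.sqrt P.q := div_nonneg hlog hsq.le
  have hδ := hP.delta_pos
  have hχ := chiL_nonneg_layer hP
  have hmax : 1 ≤ P.hmax := le_max_left _ _
  set z := weilConv P.gOdd (weilReflect P.gOdd) (Real.log P.q) + weilConv P.gOdd (weilReflect P.gOdd) (-Real.log P.q)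
    with hz
  set Sb := Real.exp ((2 * P.δ - P.a) / 2) * L * P.chiL with hSb
  have hnorm := atom_norm_sub_le_of_layer hP hq hL hΘL
  rw [← hz, ← hSb] at hnorm
  have hre : z.re + 2 * (Real.sqrt P.q * P.Itop) ≤ 8 * P.δ * Real.exp (P.a / 2) * Sb + 4 * P.δ * Sb ^ 2 := by
    have h1 := (Complex.re_le_norm (z + 2 * ((Real.sqrt P.q * P.Itop : ℝ) : ℂ))).trans hnorm
    have h2 : (z + 2 * ((Real.sqrt P.q * P.Itop : ℝ) : ℂ)).re = z.re + 2 * (Real.sqrt P.q * P.Itop) := by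
      simp [Complex.add_re, Complex.mul_re]
    linarith
  have hR : 8 * P.δ * Real.exp (P.a / 2) * Sb + 4 * P.δ * Sb ^ 2 ≤
      2 * (4 * P.δ * Real.exp P.δ * P.hmax * L * P.chiL + 2 * P.δ * (Real.exp P.δ / Real.sqrt P.q) * L ^ 2 * P.chiL ^ 2) := by
    have e1 : 8 * P.δ * Real.exp (P.a / 2) * Sb = 8 * P.δ * Real.exp P.δ * L * P.chiL := by
      rw [hSb, ← exp_top_mul_bottom P]; ring
    have e2 : 4 * P.δ * Sb ^ 2 = 4 * P.δ * (Real.exp P.δ / Real.sqrt P.q) * L ^ 2 * P.chiL ^ 2 := by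
      rw [hSb, ← exp_bottom_sq (P := P) hq1]; ring
    rw [e1, e2]
    have t1 : 8 * P.δ * Real.exp P.δ * L * P.chiL ≤ 2 * (4 * P.δ * Real.exp P.δ * P.hmax * L * P.chiL) := by
      have e : 2 * (4 * P.δ * Real.exp P.δ * P.hmax * L * P.chiL) = P.hmax * (8 * P.δ * Real.exp P.δ * L * P.chiL) := by
        ring
      rw [e]
      exact le_mul_of_one_le_left (by positivity) hmax
    nlinarith [t1]
  have hmain : Real.log P.q / Real.sqrt P.q * (2 * (Real.sqrt P.q * P.Itop)) = 2 * Real.log P.q * P.Itop := by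
    field_simp
  have h3 : Real.log P.q / Real.sqrt P.q * z.re ≤
      Real.log P.q / Real.sqrt P.q * (2 * (4 * P.δ * Real.exp P.δ * P.hmax * L * P.chiL + 2 * P.δ * (Real.exp P.δ / Real.sqrt P.q) * L ^ 2 * P.chiL ^ 2) -
        2 * (Real.sqrt P.q * P.Itop)) :=
    mul_le_mul_of_nonneg_left (by linarith) hw
  have e : Real.log P.q / Real.sqrt P.q * (2 * (4 * P.δ * Real.exp P.δ * P.hmax * L * P.chiL + 2 * P.δ * (Real.exp P.δ / Real.sqrt P.q) * L ^ 2 * P.chiL ^ 2) -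
        2 * (Real.sqrt P.q * P.Itop)) =
      2 * Real.log P.q / Real.sqrt P.q *
        (4 * P.δ * Real.exp P.δ * P.hmax * L * P.chiL + 2 * P.δ * (Real.exp P.δ / Real.sqrt P.q) * L ^ 2 * P.chiL ^ 2) -
        Real.log P.q / Real.sqrt P.q * (2 * (Real.sqrt P.q * P.Itop)) := by
    ring
  rw [e, hmain] at h3
  linarith

/-- **The atom inequality for the mollified witness under a layer majorant (eventually in `k`)**:
`(log q/√q)·Re(k_{φ_k}(log q) + k_{φ_k}(−log q)) ≤ −2 log q·I + atom(L) + e`. [THETA-CERT-cc6 §D4/§D9] -/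
theorem eventually_atom_phi_le_of_layer {qn : ℕ} (hP : P.Admissible qn) (hq : 2 ≤ P.q) {L : ℝ} (hL : 0 ≤ L)
    (hΘL : ∀ v : ℝ, -P.a ≤ v → v ≤ 2 * P.δ - P.a → ‖P.Θ (Real.exp v)‖ ≤ L) {e : ℝ} (he : 0 < e) :
    ∀ᶠ k : ℕ in atTop, Real.log P.q / Real.sqrt P.q *
        (weilConv (P.phi k) (weilReflect (P.phi k)) (Real.log P.q) +
          weilConv (P.phi k) (weilReflect (P.phi k)) (-Real.log P.q)).re ≤ -2 * Real.log P.q * P.Itop +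
        2 * Real.log P.q / Real.sqrt P.q *
        (4 * P.δ * Real.exp P.δ * P.hmax * L * P.chiL + 2 * P.δ * (Real.exp P.δ / Real.sqrt P.q) * L ^ 2 * P.chiL ^ 2) + e := by
  have hlim := tendsto_atom_phi hP
  have hlt := atom_re_le_of_layer hP hq hL hΘL
  filter_upwards [(tendsto_order.1 hlim).2 _ (show _ < -2 * Real.log P.q * P.Itop +
    2 * Real.log P.q / Real.sqrt P.q *
        (4 * P.δ * Real.exp P.δ * P.hmax * L * P.chiL + 2 * P.δ * (Real.exp P.δ / Real.sqrt P.q) * L ^ 2 * P.chiL ^ 2) + e by linarith)]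
    with k hk
  exact hk.le

/-- **The atom side of FIN under a layer majorant**: for consecutive primes `q < q⁺` and every `e > 0`, for all large `k`,
`Re Q_{S_q}(φ_k) ≤ Re Q(φ_k) − 2 log q·I + atom(L) + e`. [THETA-CERT-cc6 §D4/§D9] -/
theorem eventually_re_weilSemilocalQuadratic_phi_le_of_layer {qn : ℕ} (hP : P.Admissible qn)
    (hcons : Handoff.ConsecutivePrimes P.q qn) {L : ℝ} (hL : 0 ≤ L)
    (hΘL : ∀ v : ℝ, -P.a ≤ v → v ≤ 2 * P.δ - P.a → ‖P.Θ (Real.exp v)‖ ≤ L) {e : ℝ} (he : 0 < e) :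
    ∀ᶠ k : ℕ in atTop, (weilSemilocalQuadratic (Nat.primesBelow P.q) (P.phi k)).re ≤
      (weilQuadratic (P.phi k)).re - 2 * Real.log P.q * P.Itop +
        2 * Real.log P.q / Real.sqrt P.q *
        (4 * P.δ * Real.exp P.δ * P.hmax * L * P.chiL + 2 * P.δ * (Real.exp P.δ / Real.sqrt P.q) * L ^ 2 * P.chiL ^ 2) + e := by
  filter_upwards [eventually_re_weilSemilocalQuadratic_phi_eq hP hcons,
    eventually_atom_phi_le_of_layer hP hcons.1.two_le hL hΘL he] with k hk hle
  rw [hk]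
  linarith

/-- **THE SPINE WITH A LAYER MAJORANT**: for consecutive primes `q < q⁺`, a layer constant `L ≥ 0` with `‖Θ(e^v)‖ ≤ L` on
`[−a, 2δ − a]`, a full-form ceiling `∀ e>0, ∀ᶠ k, Re Q(φ_k) ≤ B + e`, and `B − 2 log q·I + atom(L) < 0` (`atom(L)` written out):
**`a*(S_q) < (log q⁺)/2`**. Tier 1's `weilSemilocalThreshold_lt_of_full_le` is the case `L = M_L`. [THETA-ASSIGN (AN)/FIN shape;
TIER2-SOUNDNESS-PLAN §2 E8/E10] -/
theorem weilSemilocalThreshold_lt_of_full_le_of_layer {qn : ℕ} (hP : P.Admissible qn)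
    (hcons : Handoff.ConsecutivePrimes P.q qn) {L : ℝ} (hL : 0 ≤ L)
    (hΘL : ∀ v : ℝ, -P.a ≤ v → v ≤ 2 * P.δ - P.a → ‖P.Θ (Real.exp v)‖ ≤ L)
    {B : ℝ} (hB : ∀ e : ℝ, 0 < e → ∀ᶠ k : ℕ in atTop, (weilQuadratic (P.phi k)).re ≤ B + e)
    (hlt : B - 2 * Real.log P.q * P.Itop +
      2 * Real.log P.q / Real.sqrt P.q *
        (4 * P.δ * Real.exp P.δ * P.hmax * L * P.chiL + 2 * P.δ * (Real.exp P.δ / Real.sqrt P.q) * L ^ 2 * P.chiL ^ 2) < 0) :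
    MotivicDoor.SemilocalThreshold.weilSemilocalThreshold (Nat.primesBelow P.q) < Real.log qn / 2 := by
  have hq : 1 ≤ P.q := le_trans (by norm_num) hcons.1.two_le
  set e : ℝ := -(B - 2 * Real.log P.q * P.Itop +
    2 * Real.log P.q / Real.sqrt P.q *
        (4 * P.δ * Real.exp P.δ * P.hmax * L * P.chiL + 2 * P.δ * (Real.exp P.δ / Real.sqrt P.q) * L ^ 2 * P.chiL ^ 2)) / 3 with he
  have he0 : 0 < e := by rw [he]; linarith
  obtain ⟨k, hk1, hk2, hk3⟩ := ((eventually_tsupport_phi_subset_window hP hq).and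
    ((eventually_re_weilSemilocalQuadratic_phi_le_of_layer hP hcons hL hΘL he0).and (hB e he0))).exists
  refine weilSemilocalThreshold_lt_of_phi_neg hP hk1 ?_
  have : (weilSemilocalQuadratic (Nat.primesBelow P.q) (P.phi k)).re ≤ -e := by
    have h3 : (B - 2 * Real.log P.q * P.Itop +
        2 * Real.log P.q / Real.sqrt P.q *
        (4 * P.δ * Real.exp P.δ * P.hmax * L * P.chiL + 2 * P.δ * (Real.exp P.δ / Real.sqrt P.q) * L ^ 2 * P.chiL ^ 2)) = -3 * e := by rw [he]; ring
    linarith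
  linarith

/-! ## §3 E8: the tier-2 layer constant from E1 -/

/-- **E8 — the CELLWISE bottom-layer majorant.** If `R ≥ ζ(m+1) − Σ_{k≤K}k^{−(m+1)}` and `sLayer ≥ 0` dominates the
sine-kept bracket `Σ_{k≤K}|sin(kθ₀eᵗ)|^m/k^{m+1} + R` (= `ThetaTier2.Sfun P.θ₀ R P.m K t`) on the depth layer `t ∈ [η − 2δ, η]`
(the kernel's (K1L)), then `‖Θ(e^v)‖ ≤ M₀·sLayer·e^{m(2δ−η)}` for `v ∈ [−a, 2δ − a]` (`e^v = u₁e^{−t}`, `t = x₁ − v`).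
[weil-1's E1 `norm_Θ_exp_le_sine`; TIER2-KERNEL-SPEC §2 rTerm, §5 (K5); TIER2-SOUNDNESS-PLAN §2 E8] -/
theorem norm_Θ_exp_le_ML₂ {qn : ℕ} (hP : P.Admissible qn) (K : ℕ) {R sLayer : ℝ}
    (hR : zetaTail (P.m + 1) - ∑ k ∈ Ico 1 (K + 1), 1 / (k : ℝ) ^ (P.m + 1) ≤ R) (hsL : 0 ≤ sLayer)
    (hS : ∀ t : ℝ, P.η - 2 * P.δ ≤ t → t ≤ P.η →
      (∑ k ∈ Ico 1 (K + 1), |Real.sin (k * (P.θ₀ * Real.exp t))| ^ P.m / (k : ℝ) ^ (P.m + 1)) + R ≤ sLayer)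
    {v : ℝ} (hv₁ : -P.a ≤ v) (hv : v ≤ 2 * P.δ - P.a) :
    ‖P.Θ (Real.exp v)‖ ≤ P.M₀ * sLayer * Real.exp (P.m * (2 * P.δ - P.η)) := by
  obtain ⟨-, -, -, -, -, hM₀, -⟩ := P.e1_pos hP
  set t : ℝ := P.x₁ - v with ht
  have ht₁ : P.η - 2 * P.δ ≤ t := by rw [ht]; unfold x₁; linarith
  have ht₂ : t ≤ P.η := by rw [ht]; unfold x₁; linarith
  have hev : Real.exp v = P.u₁ * Real.exp (-t) := by
    unfold u₁; rw [← Real.exp_add]; congr 1; rw [ht]; ring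
  have h1 := P.norm_Θ_exp_le_sine hP K t hR
  rw [← hev] at h1
  refine h1.trans ?_
  have hexp : Real.exp (-(P.m : ℝ) * t) ≤ Real.exp (P.m * (2 * P.δ - P.η)) := by
    refine Real.exp_le_exp.2 ?_
    have hm0 : (0 : ℝ) ≤ P.m := Nat.cast_nonneg _
    nlinarith
  calc P.M₀ * Real.exp (-(P.m : ℝ) * t) *
        ((∑ k ∈ Ico 1 (K + 1), |Real.sin (k * (P.θ₀ * Real.exp t))| ^ P.m / (k : ℝ) ^ (P.m + 1)) + R)
      ≤ P.M₀ * Real.exp (-(P.m : ℝ) * t) * sLayer :=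
        mul_le_mul_of_nonneg_left (hS t ht₁ ht₂) (by positivity)
    _ ≤ P.M₀ * Real.exp (P.m * (2 * P.δ - P.η)) * sLayer := by gcongr
    _ = P.M₀ * sLayer * Real.exp (P.m * (2 * P.δ - P.η)) := by ring

/-- **E8 in the spine's shape**: under the hypotheses of `norm_Θ_exp_le_ML₂`, the layer-majorant hypothesis `hΘL` of §2 holds with
`L = M₀·sLayer·e^{m(2δ−η)}` (and this `L ≥ 0`). [TIER2-SOUNDNESS-PLAN §2 E8] -/
theorem layer_majorant_ML₂ {qn : ℕ} (hP : P.Admissible qn) (K : ℕ) {R sLayer : ℝ}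
    (hR : zetaTail (P.m + 1) - ∑ k ∈ Ico 1 (K + 1), 1 / (k : ℝ) ^ (P.m + 1) ≤ R) (hsL : 0 ≤ sLayer)
    (hS : ∀ t : ℝ, P.η - 2 * P.δ ≤ t → t ≤ P.η →
      (∑ k ∈ Ico 1 (K + 1), |Real.sin (k * (P.θ₀ * Real.exp t))| ^ P.m / (k : ℝ) ^ (P.m + 1)) + R ≤ sLayer) :
    0 ≤ P.M₀ * sLayer * Real.exp (P.m * (2 * P.δ - P.η)) ∧
      ∀ v : ℝ, -P.a ≤ v → v ≤ 2 * P.δ - P.a →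
        ‖P.Θ (Real.exp v)‖ ≤ P.M₀ * sLayer * Real.exp (P.m * (2 * P.δ - P.η)) := by
  obtain ⟨-, -, -, -, -, hM₀, -⟩ := P.e1_pos hP
  exact ⟨by positivity, fun v hv₁ hv ↦ norm_Θ_exp_le_ML₂ hP K hR hsL hS hv₁ hv⟩

end ThetaParams

end Summit.RiemannHypothesis.RiemannHypothesis.Theorems.WeilColumn.ThetaMellin

end
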